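import Mathlib.NumberTheory.Padics.Complex
import Mathlib.NumberTheory.Padics.RingHoms
import Mathlib.RingTheory.IntegralClosure.IsIntegralClosure.Basic
import Mathlib.RingTheory.LocalRing.RingHom.Basic
import Mathlib.RingTheory.Finiteness.Ideal
import Mathlib.RingTheory.Noetherian.Basic
import Literature.NumberTheory.GaloisRepresentations.PadicAlgClFiniteSubextensionDvr
import Literature.NumberTheory.GaloisRepresentations.AbsolutelyIrreducibleReduction
import HarnessLib

/-!
# `ℤ̄_p`-valued points of local `ℤ_p`-algebras are local and `𝔪`-adically continuous
# (automatic continuity)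

Topic `NumberTheory/GaloisRepresentations`, namespace `Literature.NumberTheory.GaloisRepresentations`.
Theorems only (no definition, no named fact, no instance).  Throughout `ℚ̄_p = PadicAlgCl p` is
Mathlib's algebraic closure of `ℚ_[p]` with its `p`-adic (spectral) norm and
`ℤ̄_p = (PadicAlgCl.valued p).v.valuationSubring = {‖x‖ ≤ 1}` its valuation ring (the coefficient
ring of "`𝒪_{ℚ̄_p}`-valued points" of deformation rings and big Hecke algebras); `ℤ̄_p` is a
non-Noetherian, non-complete valuation ring of rank one whose maximal ideal `{‖x‖ < 1}` is
idempotent, so none of the usual "complete Noetherian local" automatic-continuity statements apply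
to it verbatim.  We prove:

* `isLocalHom_of_isIntegral_of_isLocalRing` — **an integral ring homomorphism out of a local ring
  into a non-zero ring is local** (`φ x` a unit ⇒ `x` a unit): if `u = φ x` is a unit, `u⁻¹` is a
  root of a monic `P ∈ R[X]`, so `φ(P^rev(x)) = u^{deg P} P(u⁻¹) = 0` while
  `P^rev(x) ∈ 1 + x R ⊆ 1 + 𝔪_R ⊆ Rˣ` — impossible in a non-zero ring.  (Mathlib's
  `RingHom.IsIntegral.isLocalHom` is the case `φ` injective, `R` arbitrary; the argument is that of
  [AtiyahMacdonald1969, Prop. 5.7].)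
* `PadicInt.ringHom_apply_sub_apply_mem_span_pow`, `PadicInt.ringHom_ext_of_forall_mem_span_pow` —
  two ring homomorphisms `ℤ_p → B` agree modulo every `p^n` (`ℕ` is dense in `ℤ_p`:
  `PadicInt.appr`), hence are EQUAL as soon as `B` is `p`-adically separated (`⋂ₙ pⁿB = 0`).
* `PadicAlgCl.eq_zero_of_forall_mem_span_pow` (`ℤ̄_p` is `p`-adically separated),
  `PadicInt.coe_ringHom_valuationSubring_apply` (**every** ring homomorphism `ℤ_p → ℤ̄_p` is the
  inclusion), `PadicInt.isIntegral_ringHom_valuationSubring` (hence integral: `ℤ̄_p` is the integral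
  closure of `ℤ_p` in `ℚ̄_p`, `PadicAlgCl.norm_le_one_iff_isIntegral`).
* **`isLocalHom_to_padicAlgClInt`** — MAIN (locality): for a local ring `R` receiving a ring
  homomorphism from `ℤ_p` (e.g. a local `𝒪`-algebra, `𝒪/ℤ_p`), EVERY ring homomorphism
  `φ : R → ℤ̄_p` is local: `φ(𝔪_R) ⊆ 𝔪_{ℤ̄_p}`, i.e. `‖φ x‖ < 1` for `x ∈ 𝔪_R`
  (`padicAlgClInt_norm_map_lt_one_of_mem_maximalIdeal`, `padicAlgClInt_map_maximalIdeal_le`).  No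
  continuity, Noetherian or completeness hypothesis on `R`, and no compatibility between `φ` and
  the `ℤ_p`-structure, is needed.
* **`padicAlgClInt_exists_maximalIdeal_pow_le_comap`** — MAIN (automatic continuity): if moreover
  `𝔪_R` is finitely generated (e.g. `R` Noetherian: `…_of_isNoetherianRing`), then for every `t`
  some power `𝔪_R^N` is mapped into `p^t ℤ̄_p`: `φ` is continuous from the `𝔪_R`-adic topology of
  `R` to the `p`-adic topology of `ℤ̄_p` (each generator goes to an element of norm `< 1`, some
  power of which has norm `≤ ‖p‖^t` since the value group is archimedean; Mathlib
  `Ideal.exists_pow_le_of_le_radical_of_fg`).  This is the "automatic continuity of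
  `𝒪_{ℚ̄_p}`-points" used to compare `𝒪_{ℚ̄_p}`-points of universal deformation rings with points of
  `Spf` of big Hecke algebras (cf. [Mazur1997Deformation, §20]); between complete Noetherian local
  rings a local homomorphism is trivially `𝔪`-adically continuous, and the present statements are
  the variant with the non-Noetherian, non-complete target `ℤ̄_p`.
* `ringHom_padicAlgClInt_ext_of_dense` — consequently two `ℤ̄_p`-points agreeing on a subset `S`
  which generates an `𝔪_R`-adically dense subring of `R` are equal.

Nearest in-tree result: `FrameRingPoints.lean` (`norm_map_lt_one_of_mem_maximalIdeal`,
`exists_norm_map_pow_le`) proves locality for `𝒪_L`-ALGEBRA maps `R →ₐ[𝒪_L] ℚ̄_p`, `L ⊆ ℚ̄_p` a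
finite subextension, and the continuity estimate for the frame ring `𝒪_L⟦X_{ij}⟧`, after
[BarnetlambEtAl2014, §1.2]; here the source may be any local ring with an abstract `ℤ_p → R`, the
maps are bare ring homomorphisms into `ℤ̄_p`, and continuity is proved for every finitely generated
`𝔪_R`.

## References

* M. F. Atiyah, I. G. Macdonald, *Introduction to Commutative Algebra* (1969), Prop. 5.7 (units in
  integral extensions). [AtiyahMacdonald1969]
* B. Mazur, *An introduction to the deformation theory of Galois representations* (1997), §20.
  [Mazur1997Deformation]
-/

noncomputable section

open Polynomial IsLocalRing

namespace Literature.NumberTheory.GaloisRepresentations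

/-! ### §1 Integral ring homomorphisms out of local rings are local -/

section IntegralLocal

variable {R B : Type*} [CommRing R] [IsLocalRing R] [CommRing B] [Nontrivial B]

/-- **An integral ring homomorphism from a local ring to a non-zero ring is a local homomorphism.**
If `φ : R → B` is integral (every element of `B` is a root of a monic polynomial with coefficients
in `φ(R)`), `R` is local and `B ≠ 0`, then `φ x ∈ Bˣ ⇒ x ∈ Rˣ`.  Proof: `u = φ x` a unit, `u⁻¹` a
root of the monic `P`; then `φ(P^rev(x)) = u^{deg P} · P(u⁻¹) = 0`, but
`P^rev(x) = 1 + x · (…) ∈ 1 + 𝔪_R` is a unit when `x ∈ 𝔪_R`, and units do not map to `0` in a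
non-zero ring.  (The argument of [AtiyahMacdonald1969, Prop. 5.7]; Mathlib's
`RingHom.IsIntegral.isLocalHom` assumes instead `φ` injective.)
[cite: AtiyahMacdonald1969, Prop. 5.7] -/
theorem isLocalHom_of_isIntegral_of_isLocalRing {φ : R →+* B} (hφ : φ.IsIntegral) :
    IsLocalHom φ := by
  refine ⟨fun x hx => ?_⟩
  by_contra hxu
  set w : Bˣ := hx.unit with hw
  have hwx : (w : B) = φ x := hx.unit_spec
  -- `w⁻¹` is integral over `R`, hence `P^rev (w) = 0`
  obtain ⟨P, hPmonic, hP⟩ := hφ ((w⁻¹ : Bˣ) : B)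
  have hrev : eval₂ φ (φ x) P.reverse = 0 := by
    have h := (eval₂_reverse_eq_zero_iff φ ((w⁻¹ : Bˣ) : B) P).2 hP
    rwa [invOf_units, inv_inv, hwx] at h
  rw [eval₂_hom] at hrev
  -- and `P^rev (x) = 1 + x · (…)` is a unit of the local ring `R`
  have hunit : IsUnit (eval x P.reverse) := by
    have hexp : eval x P.reverse = 1 - (-(x * eval x P.reverse.divX)) := by
      conv_lhs => rw [← X_mul_divX_add P.reverse]
      rw [eval_add, eval_mul, eval_X, eval_C, coeff_zero_reverse, hPmonic.leadingCoeff]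
      ring
    rw [hexp]
    refine isUnit_one_sub_self_of_mem_nonunits _ ?_
    rw [← mem_maximalIdeal]
    exact Submodule.neg_mem _ (Ideal.mul_mem_right _ _ ((mem_maximalIdeal _).2 hxu))
  -- contradiction: a unit maps to `0` in the non-zero ring `B`
  have h0 : IsUnit (0 : B) := hrev ▸ hunit.map φ
  exact zero_ne_one (isUnit_zero_iff.1 h0)

end IntegralLocal

/-! ### §2 Ring homomorphisms out of `ℤ_p` -/

section PadicIntHom

variable {p : ℕ} [Fact p.Prime] {B : Type*} [CommRing B]

/-- Two ring homomorphisms `f, g : ℤ_p → B` agree modulo `p^n` for every `n`: writing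
`x = a + p^n y` with `a ∈ ℕ` (`PadicInt.appr`), `f x - g x = p^n (f y - g y)`. [folklore] -/
theorem PadicInt.ringHom_apply_sub_apply_mem_span_pow (f g : ℤ_[p] →+* B) (x : ℤ_[p]) (n : ℕ) :
    f x - g x ∈ Ideal.span {(p : B) ^ n} := by
  obtain ⟨y, hy⟩ := Ideal.mem_span_singleton'.1 (PadicInt.appr_spec n x)
  have hx : x = (x.appr n : ℤ_[p]) + y * (p : ℤ_[p]) ^ n := by rw [hy]; ring
  refine Ideal.mem_span_singleton'.2 ⟨f y - g y, ?_⟩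
  rw [hx, map_add, map_add, map_mul, map_mul, map_pow, map_pow, map_natCast, map_natCast,
    map_natCast, map_natCast]
  ring

/-- **Ring homomorphisms out of `ℤ_p` into a `p`-adically separated ring are unique**: if
`⋂ₙ pⁿ B = 0` then any two ring homomorphisms `ℤ_p → B` coincide. [folklore] -/
theorem PadicInt.ringHom_ext_of_forall_mem_span_pow
    (hB : ∀ b : B, (∀ n : ℕ, b ∈ Ideal.span {(p : B) ^ n}) → b = 0) (f g : ℤ_[p] →+* B) :
    f = g :=
  RingHom.ext fun x =>
    sub_eq_zero.1 (hB _ fun n => PadicInt.ringHom_apply_sub_apply_mem_span_pow f g x n)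

end PadicIntHom

/-! ### §3 The valuation ring `ℤ̄_p` of `ℚ̄_p` -/

/-- `𝓩_[p] = ℤ̄_p`, the valuation ring of `ℚ̄_p` (local notation for this file only). -/
local notation3 "𝓩_[" p "]" => (PadicAlgCl.valued p).v.valuationSubring

section PadicAlgClInt

variable (p : ℕ) [Fact p.Prime]

/-- `‖p‖ = p⁻¹` in `ℚ̄_p` (a private copy of
`Literature.NumberTheory.GaloisRepresentations.PadicAlgCl.norm_natCast_self`, whose module
`LAdicCharacterUnramifiedAEProofs` is a heavy import). [folklore] -/
private theorem PadicAlgCl.norm_natCast_prime : ‖(p : PadicAlgCl p)‖ = (p : ℝ)⁻¹ := by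
  rw [← map_natCast (algebraMap ℚ_[p] (PadicAlgCl p)) p]
  change ‖(((p : ℕ) : ℚ_[p]) : PadicAlgCl p)‖ = _
  rw [PadicAlgCl.norm_extends, Padic.norm_p]

/-- `0 < ‖p‖ < 1` in `ℚ̄_p`. [folklore] -/
theorem PadicAlgCl.norm_natCast_prime_pos_lt_one :
    0 < ‖(p : PadicAlgCl p)‖ ∧ ‖(p : PadicAlgCl p)‖ < 1 := by
  have hp : 1 < (p : ℝ) := by exact_mod_cast (Fact.out : p.Prime).one_lt
  rw [PadicAlgCl.norm_natCast_prime]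
  exact ⟨inv_pos.2 (zero_lt_one.trans hp), inv_lt_one_of_one_lt₀ hp⟩

/-- Elements of `ℤ̄_p` have norm `≤ 1`. [folklore] -/
theorem PadicAlgCl.norm_coe_valuationSubring_le_one (x : 𝓩_[p]) : ‖(x : PadicAlgCl p)‖ ≤ 1 :=
  (padicAlgCl_mem_valuationSubring_iff p _).1 x.2

/-- In `ℤ̄_p`, `p^t ∣ x` iff `‖x‖ ≤ ‖p‖^t` (a valuation ring). [folklore] -/
theorem PadicAlgCl.mem_span_pow_valuationSubring_iff (t : ℕ) (x : 𝓩_[p]) :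
    x ∈ Ideal.span {((p : ℕ) : 𝓩_[p]) ^ t} ↔ ‖(x : PadicAlgCl p)‖ ≤ ‖(p : PadicAlgCl p)‖ ^ t := by
  obtain ⟨hp0, -⟩ := PadicAlgCl.norm_natCast_prime_pos_lt_one p
  have hp0' : (p : PadicAlgCl p) ^ t ≠ 0 := pow_ne_zero _ (norm_pos_iff.1 hp0)
  have hcoe : ∀ y : 𝓩_[p], (((y * ((p : ℕ) : 𝓩_[p]) ^ t : 𝓩_[p])) : PadicAlgCl p) =
      (y : PadicAlgCl p) * (p : PadicAlgCl p) ^ t := fun y => by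
    push_cast; rfl
  rw [Ideal.mem_span_singleton']
  constructor
  · rintro ⟨y, rfl⟩
    rw [hcoe, norm_mul, norm_pow]
    exact mul_le_of_le_one_left (pow_nonneg (norm_nonneg _) _)
      (PadicAlgCl.norm_coe_valuationSubring_le_one p y)
  · intro hx
    have hy : ‖(x : PadicAlgCl p) / (p : PadicAlgCl p) ^ t‖ ≤ 1 := by
      rw [norm_div, norm_pow]
      exact div_le_one_of_le₀ hx (pow_nonneg (norm_nonneg _) _)
    refine ⟨⟨(x : PadicAlgCl p) / (p : PadicAlgCl p) ^ t,
      (padicAlgCl_mem_valuationSubring_iff p _).2 hy⟩, Subtype.ext ?_⟩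
    rw [hcoe]
    exact div_mul_cancel₀ _ hp0'

/-- **`ℤ̄_p` is `p`-adically separated**: an element divisible by every power of `p` is `0`
(its norm is `≤ ‖p‖ⁿ → 0`). [folklore] -/
theorem PadicAlgCl.eq_zero_of_forall_mem_span_pow (b : 𝓩_[p])
    (hb : ∀ n : ℕ, b ∈ Ideal.span {((p : ℕ) : 𝓩_[p]) ^ n}) : b = 0 := by
  by_contra hb0
  have hb0' : (b : PadicAlgCl p) ≠ 0 := fun h => hb0 (Subtype.ext h)
  obtain ⟨hp0, hp1⟩ := PadicAlgCl.norm_natCast_prime_pos_lt_one p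
  obtain ⟨n, hn⟩ := exists_pow_lt_of_lt_one (norm_pos_iff.2 hb0') hp1
  exact (lt_irrefl _) (hn.trans_le ((PadicAlgCl.mem_span_pow_valuationSubring_iff p n b).1 (hb n)))

/-- The inclusion `ℤ_p → ℚ̄_p` lands in `ℤ̄_p`. [folklore] -/
theorem PadicInt.algebraMap_padicAlgCl_mem_valuationSubring (x : ℤ_[p]) :
    algebraMap ℤ_[p] (PadicAlgCl p) x ∈ 𝓩_[p] := by
  rw [padicAlgCl_mem_valuationSubring_iff,
    IsScalarTower.algebraMap_apply ℤ_[p] ℚ_[p] (PadicAlgCl p)]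
  change ‖((x : ℚ_[p]) : PadicAlgCl p)‖ ≤ 1
  rw [PadicAlgCl.norm_extends]
  exact PadicInt.norm_le_one x

/-- **Every ring homomorphism `ℤ_p → ℤ̄_p` is the inclusion** (`ℤ̄_p` is `p`-adically separated and
`ℕ` is dense in `ℤ_p`). [folklore] -/
theorem PadicInt.coe_ringHom_valuationSubring_apply (f : ℤ_[p] →+* 𝓩_[p]) (x : ℤ_[p]) :
    ((f x : 𝓩_[p]) : PadicAlgCl p) = algebraMap ℤ_[p] (PadicAlgCl p) x := by
  let c : ℤ_[p] →+* 𝓩_[p] := (algebraMap ℤ_[p] (PadicAlgCl p)).codRestrict _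
    (PadicInt.algebraMap_padicAlgCl_mem_valuationSubring p)
  have hfc : f = c :=
    PadicInt.ringHom_ext_of_forall_mem_span_pow (PadicAlgCl.eq_zero_of_forall_mem_span_pow p) f c
  rw [hfc]
  rfl

/-- The composite of any `f : ℤ_p → ℤ̄_p` with `ℤ̄_p ⊆ ℚ̄_p` is the structure map. [folklore] -/
theorem PadicInt.subtype_comp_ringHom_valuationSubring (f : ℤ_[p] →+* 𝓩_[p]) :
    ((PadicAlgCl.valued p).v.valuationSubring.subtype).comp f = algebraMap ℤ_[p] (PadicAlgCl p) :=
  RingHom.ext fun x => PadicInt.coe_ringHom_valuationSubring_apply p f x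

/-- **`ℤ̄_p` is integral over `ℤ_p` along every ring homomorphism `f : ℤ_p → ℤ̄_p`** (`ℤ̄_p` is the
integral closure of `ℤ_p` in `ℚ̄_p`, `PadicAlgCl.norm_le_one_iff_isIntegral`, and `f` is the
inclusion). [folklore] -/
theorem PadicInt.isIntegral_ringHom_valuationSubring (f : ℤ_[p] →+* 𝓩_[p]) : f.IsIntegral := by
  intro u
  obtain ⟨P, hPmonic, hP⟩ := (PadicAlgCl.norm_le_one_iff_isIntegral (u : PadicAlgCl p)).1
    (PadicAlgCl.norm_coe_valuationSubring_le_one p u)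
  refine ⟨P, hPmonic, Subtype.ext ?_⟩
  have h := Polynomial.hom_eval₂ P f ((PadicAlgCl.valued p).v.valuationSubring.subtype) u
  rw [PadicInt.subtype_comp_ringHom_valuationSubring] at h
  change (((eval₂ f u P : 𝓩_[p])) : PadicAlgCl p) = _ at h
  rw [ZeroMemClass.coe_zero, h]
  exact hP

/-- Units of `ℤ̄_p` are the elements of norm `1`. [folklore] -/
theorem PadicAlgCl.isUnit_valuationSubring_iff (x : 𝓩_[p]) :
    IsUnit x ↔ ‖(x : PadicAlgCl p)‖ = 1 := by
  rw [(Valuation.valuationSubring.integers (PadicAlgCl.valued p).v).isUnit_iff_valuation_eq_one,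
    PadicAlgCl.valuation_def, ← NNReal.coe_inj, coe_nnnorm, NNReal.coe_one]
  rfl

/-- The maximal ideal of `ℤ̄_p` is `{‖x‖ < 1}`. [folklore] -/
theorem PadicAlgCl.mem_maximalIdeal_valuationSubring_iff (x : 𝓩_[p]) :
    x ∈ maximalIdeal 𝓩_[p] ↔ ‖(x : PadicAlgCl p)‖ < 1 :=
  mem_maximalIdeal_iff_norm_lt_one (padicAlgCl_mem_valuationSubring_iff p) x

end PadicAlgClInt

/-! ### §4 `ℤ̄_p`-points of local `ℤ_p`-algebras: locality and automatic continuity -/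

section Points

variable (p : ℕ) [Fact p.Prime] {R : Type*} [CommRing R] [IsLocalRing R]

/-- **Locality of `ℤ̄_p`-points.**  Let `R` be a local ring admitting a ring homomorphism
`i : ℤ_p → R` (e.g. a local `𝒪`-algebra for `𝒪` a `ℤ_p`-algebra).  Then EVERY ring homomorphism
`φ : R → ℤ̄_p` is a local homomorphism (`φ x ∈ ℤ̄_pˣ ⇒ x ∈ Rˣ`): `ℤ̄_p` is integral over `ℤ_p`
along `φ ∘ i` (which is the inclusion), hence over `R` along `φ`, and integral homomorphisms out of
local rings are local. [folklore] -/
theorem isLocalHom_to_padicAlgClInt (i : ℤ_[p] →+* R) (φ : R →+* 𝓩_[p]) : IsLocalHom φ :=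
  isLocalHom_of_isIntegral_of_isLocalRing
    (RingHom.IsIntegral.tower_top i φ (PadicInt.isIntegral_ringHom_valuationSubring p (φ.comp i)))

/-- `φ(𝔪_R) ⊆ 𝔪_{ℤ̄_p}` for every ring homomorphism `φ : R → ℤ̄_p` out of a local ring over `ℤ_p`.
[folklore] -/
theorem padicAlgClInt_map_mem_maximalIdeal (i : ℤ_[p] →+* R) (φ : R →+* 𝓩_[p]) {x : R}
    (hx : x ∈ maximalIdeal R) : φ x ∈ maximalIdeal 𝓩_[p] := by
  haveI := isLocalHom_to_padicAlgClInt p i φ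
  exact map_nonunit φ x hx

/-- `𝔪_R · ℤ̄_p ⊆ 𝔪_{ℤ̄_p}`: the extension of the maximal ideal along any `φ : R → ℤ̄_p`.
[folklore] -/
theorem padicAlgClInt_map_maximalIdeal_le (i : ℤ_[p] →+* R) (φ : R →+* 𝓩_[p]) :
    (maximalIdeal R).map φ ≤ maximalIdeal 𝓩_[p] :=
  Ideal.map_le_iff_le_comap.2 fun _ hx => padicAlgClInt_map_mem_maximalIdeal p i φ hx

/-- **`‖φ x‖ < 1` for `x ∈ 𝔪_R`**: the values of a `ℤ̄_p`-point of a local `ℤ_p`-algebra on the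
maximal ideal are topologically nilpotent. [folklore] -/
theorem padicAlgClInt_norm_map_lt_one_of_mem_maximalIdeal (i : ℤ_[p] →+* R) (φ : R →+* 𝓩_[p])
    {x : R} (hx : x ∈ maximalIdeal R) : ‖((φ x : 𝓩_[p]) : PadicAlgCl p)‖ < 1 :=
  (PadicAlgCl.mem_maximalIdeal_valuationSubring_iff p _).1
    (padicAlgClInt_map_mem_maximalIdeal p i φ hx)

/-- Every element of `𝔪_R` has a power mapped into `p^t ℤ̄_p` (the value group `|ℚ̄_p^×| ⊆ ℝ_{>0}`
is archimedean). [folklore] -/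
theorem padicAlgClInt_exists_pow_mem_comap_span_pow (i : ℤ_[p] →+* R) (φ : R →+* 𝓩_[p]) {x : R}
    (hx : x ∈ maximalIdeal R) (t : ℕ) :
    ∃ N : ℕ, x ^ N ∈ (Ideal.span {((p : ℕ) : 𝓩_[p]) ^ t}).comap φ := by
  obtain ⟨hp0, -⟩ := PadicAlgCl.norm_natCast_prime_pos_lt_one p
  obtain ⟨N, hN⟩ := exists_pow_lt_of_lt_one (pow_pos hp0 t)
    (padicAlgClInt_norm_map_lt_one_of_mem_maximalIdeal p i φ hx)
  refine ⟨N, ?_⟩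
  rw [Ideal.mem_comap, PadicAlgCl.mem_span_pow_valuationSubring_iff, map_pow,
    SubmonoidClass.coe_pow, norm_pow]
  exact hN.le

/-- `𝔪_R` lies in the radical of `φ⁻¹(p^t ℤ̄_p)`. [folklore] -/
theorem padicAlgClInt_maximalIdeal_le_radical_comap (i : ℤ_[p] →+* R) (φ : R →+* 𝓩_[p]) (t : ℕ) :
    maximalIdeal R ≤ ((Ideal.span {((p : ℕ) : 𝓩_[p]) ^ t}).comap φ).radical :=
  fun _ hx => padicAlgClInt_exists_pow_mem_comap_span_pow p i φ hx t

/-- **Automatic continuity of `ℤ̄_p`-points.**  Let `R` be a local ring over `ℤ_p` whose maximal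
ideal is finitely generated, and `φ : R → ℤ̄_p` any ring homomorphism.  Then for every `t` there is
`N` with `φ(𝔪_R^N) ⊆ p^t ℤ̄_p`: `φ` is continuous from the `𝔪_R`-adic topology to the `p`-adic
topology (and so extends to completions, factors through `R/𝔪_R^N → ℤ̄_p/p^t`, etc.).
[folklore] -/
theorem padicAlgClInt_exists_maximalIdeal_pow_le_comap (i : ℤ_[p] →+* R)
    (hfg : (maximalIdeal R).FG) (φ : R →+* 𝓩_[p]) (t : ℕ) :
    ∃ N : ℕ, maximalIdeal R ^ N ≤ (Ideal.span {((p : ℕ) : 𝓩_[p]) ^ t}).comap φ :=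
  Ideal.exists_pow_le_of_le_radical_of_fg (padicAlgClInt_maximalIdeal_le_radical_comap p i φ t) hfg

/-- **Automatic continuity of `ℤ̄_p`-points of Noetherian local `ℤ_p`-algebras** (e.g. complete
Noetherian local `𝒪`-algebras: universal deformation rings, Hecke algebras `𝕋_𝔪` known to be
Noetherian): every ring homomorphism `φ : R → ℤ̄_p` satisfies `φ(𝔪_R^N) ⊆ p^t ℤ̄_p` for some
`N = N(t)`. [folklore] -/
theorem padicAlgClInt_exists_maximalIdeal_pow_le_comap_of_isNoetherianRing [IsNoetherianRing R]
    (i : ℤ_[p] →+* R) (φ : R →+* 𝓩_[p]) (t : ℕ) :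
    ∃ N : ℕ, maximalIdeal R ^ N ≤ (Ideal.span {((p : ℕ) : 𝓩_[p]) ^ t}).comap φ :=
  padicAlgClInt_exists_maximalIdeal_pow_le_comap p i (IsNoetherian.noetherian _) φ t

/-- Norm form of automatic continuity: `‖φ x‖ ≤ ‖p‖^t` for all `x ∈ 𝔪_R^N`. [folklore] -/
theorem padicAlgClInt_exists_forall_norm_map_le_of_mem_pow (i : ℤ_[p] →+* R)
    (hfg : (maximalIdeal R).FG) (φ : R →+* 𝓩_[p]) (t : ℕ) :
    ∃ N : ℕ, ∀ x ∈ maximalIdeal R ^ N,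
      ‖((φ x : 𝓩_[p]) : PadicAlgCl p)‖ ≤ ‖(p : PadicAlgCl p)‖ ^ t := by
  obtain ⟨N, hN⟩ := padicAlgClInt_exists_maximalIdeal_pow_le_comap p i hfg φ t
  exact ⟨N, fun x hx => (PadicAlgCl.mem_span_pow_valuationSubring_iff p t _).1 (hN hx)⟩

/-- Congruence form of automatic continuity: with `N` as in
`padicAlgClInt_exists_maximalIdeal_pow_le_comap`, `x ≡ y (mod 𝔪_R^N)` implies
`φ x ≡ φ y (mod p^t)`. [folklore] -/
theorem padicAlgClInt_map_sub_map_mem_span_pow (φ : R →+* 𝓩_[p]) {t N : ℕ}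
    (hN : maximalIdeal R ^ N ≤ (Ideal.span {((p : ℕ) : 𝓩_[p]) ^ t}).comap φ) {x y : R}
    (hxy : x - y ∈ maximalIdeal R ^ N) : φ x - φ y ∈ Ideal.span {((p : ℕ) : 𝓩_[p]) ^ t} := by
  rw [← map_sub]
  exact hN hxy

/-- **`ℤ̄_p`-points are determined on an `𝔪_R`-adically dense subring.**  Let `R` be a local ring
over `ℤ_p` with finitely generated maximal ideal and `S ⊆ R` a subset generating an `𝔪_R`-adically
dense subring (every `x ∈ R` is congruent modulo every `𝔪_R^N` to an element of the subring
generated by `S` — e.g. `S = 𝒪 ∪ {tr ρ(g)}` in a universal deformation ring, by Carayol).  Then two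
ring homomorphisms `φ, ψ : R → ℤ̄_p` which agree on `S` are equal (automatic continuity of both and
`p`-adic separatedness of `ℤ̄_p`). [folklore] -/
theorem ringHom_padicAlgClInt_ext_of_dense (i : ℤ_[p] →+* R) (hfg : (maximalIdeal R).FG)
    {S : Set R} (φ ψ : R →+* 𝓩_[p]) (hS : Set.EqOn φ ψ S)
    (hdense : ∀ (N : ℕ) (x : R), ∃ x₀ ∈ Subring.closure S, x - x₀ ∈ maximalIdeal R ^ N) :
    φ = ψ := by
  have hS' : ∀ x₀ ∈ Subring.closure S, φ x₀ = ψ x₀ := fun x₀ hx₀ =>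
    (Subring.closure_le (t := φ.eqLocus ψ)).2 hS hx₀
  refine RingHom.ext fun x => sub_eq_zero.1
    (PadicAlgCl.eq_zero_of_forall_mem_span_pow p _ fun t => ?_)
  obtain ⟨N₁, hN₁⟩ := padicAlgClInt_exists_maximalIdeal_pow_le_comap p i hfg φ t
  obtain ⟨N₂, hN₂⟩ := padicAlgClInt_exists_maximalIdeal_pow_le_comap p i hfg ψ t
  obtain ⟨x₀, hx₀, hx⟩ := hdense (N₁ + N₂) x
  have h₁ : φ x - φ x₀ ∈ Ideal.span {((p : ℕ) : 𝓩_[p]) ^ t} :=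
    padicAlgClInt_map_sub_map_mem_span_pow p φ hN₁
      (Ideal.pow_le_pow_right (Nat.le_add_right N₁ N₂) hx)
  have h₂ : ψ x - ψ x₀ ∈ Ideal.span {((p : ℕ) : 𝓩_[p]) ^ t} :=
    padicAlgClInt_map_sub_map_mem_span_pow p ψ hN₂
      (Ideal.pow_le_pow_right (Nat.le_add_left N₂ N₁) hx)
  have h := Ideal.sub_mem _ h₁ h₂
  rwa [hS' x₀ hx₀, sub_sub_sub_cancel_right] at h

end Points

end Literature.NumberTheory.GaloisRepresentations

end
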